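import Summits.Langlands.Langlands.Theorems.IrreducibilityBySelfDualityReciprocityUpToIrreducibilityAboveUnramified
import HarnessLib

/-!
# Line `Sketch` for the crux `ReciprocityUpToIrreducibility` (item stmt-Langlands-14328), continuation c4:
# the cuspidal L-algebraic `GL₁` datum `π_θ = ℂ·(θ ∘ det)/⊥` of a finite-order Hecke character

Support file (closes nothing; registered stub `stub_rankOne_cuspidalModel_of_isFiniteOrder` of line
`Sketch`, continuation lead c4, prover-line-stmt-Langlands-14328-c4-0).

In rank one, direction (A) of the summit for a finite-order Hecke character `θ` of the number field
`K` needs an EXPLICIT cuspidal, L-algebraic automorphic representation datum of `GL₁(𝔸_K)` realising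
`θ`: the line `W = ℂ · (θ ∘ det)` over `W' = ⊥`.  This file builds it from the tree's rank-one
dictionary:

* `cuspidal_detTwist_glOne_le` — the Borel–Jacquet datum `π_θ = ℂ·(θ ∘ det)/⊥`
  (`exists_automorphicRepData_detTwist_glOne`) is cuspidal: `θ ∘ det` is an automorphic form
  (`isAutomorphicForm_detTwist_glOne`) and on `GL₁` the cusp conditions (`0 < k < 1`) are vacuous.
* `heckeCharacter_detTwist_glOne` — `π_θ` has Hecke character `θ`: right translation by `g`
  multiplies `θ ∘ det` by `θ(det g)` (`rightTranslation_detTwist_glOne`).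
* `isLAlgebraic_detTwist_glOne_of_isFiniteOrder` — `π_θ` is L-algebraic: `θ` has infinity type
  `(0, 0)` (`HeckeCharacter.IsFiniteOrder.isAlgebraic`,
  `HeckeCharacter.isAlgebraic_iff_exists_hasInfinityType`), so `π_θ` has the infinity type
  `ι ↦ {(-n_ι, -n_ῑ)}` with INTEGRAL exponents
  (`AutomorphicRepData.exists_hasInfinityType_of_hasInfinityType_heckeCharacter_glOne`,
  `ArchWeight.exists_int_sub`).
* `exists_cuspidal_detTwist_glOne_of_isFiniteOrder` / `stub_rankOne_cuspidalModel_of_isFiniteOrder`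
  — the registered stub: `∃ π : CuspidalAutomorphicRepData 1 K hcpt` with `W = ℂ·(θ ∘ det)`,
  `W' = ⊥`, `π` L-algebraic.

No definitions; standard axioms only.
-/

noncomputable section

set_option linter.dupNamespace false -- project-wide option (lakefile weak.linter.dupNamespace); `Summit.Langlands.Langlands` is the mandated namespace

open scoped MatrixGroups Matrix NumberField Classical Polynomial
open Filter IsDedekindDomain Field Polynomial
open Literature.NumberTheory.Automorphic Literature.NumberTheory.GaloisRepresentations
open Literature.NumberTheory.PAdicHodge
open Summit.Langlands

namespace Summit.Langlands.Langlands.Theorems.ReciprocityUpToIrreducibility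

section RankOneCuspidalModel

variable {K : Type} [Field K] [NumberField K]

/-- **`θ ∘ det` spans a space of cusp forms on `GL₁(𝔸_K)`.**  For an automorphic representation
datum `π` of `GL₁(𝔸_K)` with `W = ℂ · (θ ∘ det)`, `W ≤ 𝒜₀`: `θ ∘ det` is an automorphic form
(`isAutomorphicForm_detTwist_glOne`) and on `GL₁` there is no proper standard parabolic, so the
cusp conditions `0 < k < 1` are vacuous. [cite: BorelJacquet1979, 4.6] -/
theorem cuspidal_detTwist_glOne_le (hcpt : isCompact_glFiniteIntegralLevel 1 K) (θ : HeckeCharacter K)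
    {π : AutomorphicRepData (AutomorphyDatum.gl 1 K hcpt)}
    (hW : π.W = Submodule.span ℂ {fun g : (AdelicGroupData.gl 1 K).Adelic => (detTwist 1 θ g : ℂ)}) :
    π.W ≤ cuspFormsGL 1 K hcpt := by
  rw [hW, Submodule.span_le]
  rintro _ rfl
  exact IsCuspFormGL.mem_cuspFormsGL
    ⟨isAutomorphicForm_detTwist_glOne hcpt θ, fun k hk hk1 => absurd hk1 (by omega)⟩

/-- **`π_θ = ℂ·(θ ∘ det)/W'` has Hecke character `θ`.**  Right translation by `g ∈ GL₁(𝔸_K)`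
multiplies `θ ∘ det` by `θ(det g)` (`rightTranslation_detTwist_glOne`), so
`R(g)φ - θ(det g) • φ = 0 ∈ W'` for every `φ ∈ W = ℂ · (θ ∘ det)`. [cite: BorelJacquet1979, 4.6] -/
theorem heckeCharacter_detTwist_glOne {hcpt : isCompact_glFiniteIntegralLevel 1 K} (θ : HeckeCharacter K)
    {π : AutomorphicRepData (AutomorphyDatum.gl 1 K hcpt)}
    (hW : π.W = Submodule.span ℂ {fun g : (AdelicGroupData.gl 1 K).Adelic => (detTwist 1 θ g : ℂ)}) :
    ∀ (g : (AdelicGroupData.gl 1 K).Adelic), ∀ φ ∈ π.W,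
      rightTranslation (AdelicGroupData.gl 1 K) g φ -
        ((θ (Matrix.GeneralLinearGroup.det g) : ℂˣ) : ℂ) • φ ∈ π.W' := by
  intro g φ hφ
  rw [hW, Submodule.mem_span_singleton] at hφ
  obtain ⟨c, rfl⟩ := hφ
  rw [map_smul, rightTranslation_detTwist_glOne, detTwist_apply, smul_comm, sub_self]
  exact π.W'.zero_mem

/-- **`π_θ` is L-algebraic for `θ` of finite order.**  A finite-order Hecke character is algebraic
of infinity type `(p, q) = (0, 0)` (`HeckeCharacter.IsFiniteOrder.isAlgebraic`,
`HeckeCharacter.isAlgebraic_iff_exists_hasInfinityType`); an automorphic representation datum of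
`GL₁(𝔸_K)` with Hecke character `θ` then has the infinity type `ι ↦ {(-n_ι, -n_ῑ)}`
(`AutomorphicRepData.exists_hasInfinityType_of_hasInfinityType_heckeCharacter_glOne`), whose
exponents are integers (`a = -n_ι ∈ ℤ`, `a - b ∈ ℤ`). [cite: BuzzardGeeLMS2014, Def. 3.1.1]
[cite: Clozel1990, §3.3] -/
theorem isLAlgebraic_detTwist_glOne_of_isFiniteOrder {hcpt : isCompact_glFiniteIntegralLevel 1 K}
    {θ : HeckeCharacter K} (hθ : θ.IsFiniteOrder)
    {π : AutomorphicRepData (AutomorphyDatum.gl 1 K hcpt)}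
    (hW : π.W = Submodule.span ℂ {fun g : (AdelicGroupData.gl 1 K).Adelic => (detTwist 1 θ g : ℂ)}) :
    π.IsLAlgebraic := by
  classical
  obtain ⟨p, q, hpq⟩ := (θ.isAlgebraic_iff_exists_hasInfinityType).mp hθ.isAlgebraic
  obtain ⟨T, hT, hTa⟩ :=
    π.exists_hasInfinityType_of_hasInfinityType_heckeCharacter_glOne
      (heckeCharacter_detTwist_glOne θ hW) hpq
  refine ⟨T, hT, fun σ w hw => ?_⟩
  have ha : w.a = -((HeckeCharacter.embExponent p q σ : ℤ) : ℂ) := by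
    have hmem : w.a ∈ (T σ).map ArchWeight.a := Multiset.mem_map_of_mem _ hw
    rw [hTa σ] at hmem
    exact Multiset.mem_singleton.mp hmem
  obtain ⟨m, hm⟩ := w.exists_int_sub
  refine ⟨-HeckeCharacter.embExponent p q σ, -HeckeCharacter.embExponent p q σ - m, ?_, ?_⟩
  · rw [ha]
    push_cast
    ring
  · have hb : w.b = w.a - m := by rw [← hm]; ring
    rw [hb, ha]
    push_cast
    ring

/-- **The cuspidal L-algebraic `GL₁` datum of a finite-order Hecke character.**  For `θ` of finite
order, the Borel–Jacquet datum `π_θ = ℂ·(θ ∘ det)/⊥` of `GL₁(𝔸_K)`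
(`exists_automorphicRepData_detTwist_glOne`) is cuspidal (`cuspidal_detTwist_glOne_le`) and
L-algebraic (`isLAlgebraic_detTwist_glOne_of_isFiniteOrder`). [cite: BorelJacquet1979, 4.6]
[cite: BuzzardGeeLMS2014, Def. 3.1.1] -/
theorem exists_cuspidal_detTwist_glOne_of_isFiniteOrder (hcpt : isCompact_glFiniteIntegralLevel 1 K)
    {θ : HeckeCharacter K} (hθ : θ.IsFiniteOrder) :
    ∃ π : CuspidalAutomorphicRepData 1 K hcpt,
      π.1.W = Submodule.span ℂ {fun g : (AdelicGroupData.gl 1 K).Adelic => (detTwist 1 θ g : ℂ)} ∧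
      π.1.W' = ⊥ ∧ π.1.IsLAlgebraic := by
  obtain ⟨π₀, hW, hW'⟩ := exists_automorphicRepData_detTwist_glOne hcpt θ
  exact ⟨⟨π₀, cuspidal_detTwist_glOne_le hcpt θ hW⟩, hW, hW',
    isLAlgebraic_detTwist_glOne_of_isFiniteOrder hθ hW⟩

end RankOneCuspidalModel

/-- **Registered stub `stub_rankOne_cuspidalModel_of_isFiniteOrder` of line `Sketch` (crux
stmt-Langlands-14328, c4), closed form of `exists_cuspidal_detTwist_glOne_of_isFiniteOrder`.**  For a
finite-order Hecke character `θ` of a number field `K`, the line `ℂ · (θ ∘ det)` over `⊥` is a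
cuspidal, L-algebraic automorphic representation datum of `GL₁(𝔸_K)` (Borel–Jacquet model; cusp
conditions vacuous on `GL₁`; infinity type `ι ↦ {(-n_ι, -n_ῑ)}` with integral exponents since `θ`
has infinity type `(0, 0)`). [cite: BorelJacquet1979, 4.6] [cite: BuzzardGeeLMS2014, Def. 3.1.1] -/
theorem stub_rankOne_cuspidalModel_of_isFiniteOrder :
    ∀ (K : Type) [Field K] [NumberField K] (hcpt : isCompact_glFiniteIntegralLevel 1 K)
      (θ : HeckeCharacter K), θ.IsFiniteOrder →
      ∃ π : CuspidalAutomorphicRepData 1 K hcpt,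
        π.1.W = Submodule.span ℂ {fun g : (AdelicGroupData.gl 1 K).Adelic => (detTwist 1 θ g : ℂ)} ∧
        π.1.W' = ⊥ ∧ π.1.IsLAlgebraic :=
  fun _ _ _ hcpt _ hθ => exists_cuspidal_detTwist_glOne_of_isFiniteOrder hcpt hθ

end Summit.Langlands.Langlands.Theorems.ReciprocityUpToIrreducibility

end
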